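import Summits.CriticalPhenomena.SAWScalingLimit.Theorems.CriticalBubbleBound.Negative.CriticalBubbleBoundSupercriticalFalse

/-!
# Negative-side results for the crux `SAWTotalPositivity.CriticalBubbleBound` (stmt-CriticalPhenomena-7117):
length decomposition `K_x(0,w) = Σ_n c_n(w) x^n`, the subcritical side is TRUE uniformly in all pairs, and left-continuity: crux ⟺ bounded approach to criticality (work-file §5, §11).

Refuter `cdisprove` (standing adversary); the full indexed work file is
`Summits/CriticalPhenomena/SAWScalingLimit/Cruxes/CriticalBubbleBound/Disproof.lean`.
-/

noncomputable section

open MeasureTheory Filter Topology Set Function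
open Literature.Probability.LatticeModels Literature.Probability.Percolation
open Literature.Probability.RandomPlanarGeometry Literature.Probability.RandomPlanarGeometry.SAW
open Literature.Barriers.CriticalPhenomena.SupercriticalSAW
open scoped ENNReal NNReal BigOperators

namespace Summit.CriticalPhenomena.SAWScalingLimit.Theorems.CriticalBubbleBound.Negative

open Summit.CriticalPhenomena.SAWScalingLimit.Theses.SAWTotalPositivity (CriticalBubbleBound)

/-! ## §5 The length decomposition `K_x(0,w) = Σ_n c_n(w) x^n`; the subcritical side is TRUE -/

/-- The `n`-step SAWs `0 → w`, as a subtype of `LatticeSAW 0 w`, are the tree's finite set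
`Zd.sawWalksAt 2 n w` (whose cardinality is `c_n(w) = Zd.countAt 2 n w`). [folklore] -/
def fiberEquiv (n : ℕ) (w : Site 2) :
    {p : LatticeSAW 0 w // p.1.length = n} ≃ ↥(Zd.sawWalksAt 2 n w) where
  toFun p := ⟨p.1.1, Zd.mem_sawWalksAt.2 ⟨p.1.2, p.2⟩⟩
  invFun q := ⟨⟨q.1, (Zd.mem_sawWalksAt.1 q.2).1⟩, (Zd.mem_sawWalksAt.1 q.2).2⟩
  left_inv _ := rfl
  right_inv _ := rfl

/-- **Length decomposition of the lattice kernel**: `K_x(0,w) = Σ_n c_n(w) · x^n` in `[0, ∞]`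
(any real `x`; `c_n(w)` = number of `n`-step SAWs of `ℤ²` from `0` to `w`). With §1 this makes
the crux LITERALLY `Σ_n c_n(0,e) x_c^n < ∞` for the unit vectors `e`. [cite: MadrasSlade1993, §1.4] -/
theorem latticeKernel_zero_eq_tsum_countAt (x : ℝ) (w : Site 2) :
    latticeKernel x 0 w = ∑' n : ℕ, (Zd.countAt 2 n w : ℝ≥0∞) * ENNReal.ofReal (x ^ n) := by
  rw [latticeKernel, ← (Equiv.sigmaFiberEquiv fun p : LatticeSAW 0 w => p.1.length).tsum_eq,
    ENNReal.tsum_sigma']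
  refine tsum_congr fun n => ?_
  calc ∑' p : {p : LatticeSAW 0 w // p.1.length = n},
        ENNReal.ofReal (x ^ ((Equiv.sigmaFiberEquiv fun p : LatticeSAW 0 w => p.1.length) ⟨n, p⟩).1.length)
      = ∑' p : {p : LatticeSAW 0 w // p.1.length = n}, ENNReal.ofReal (x ^ n) := by
        refine tsum_congr fun p => ?_
        simp only [Equiv.sigmaFiberEquiv_apply]
        rw [p.2]
    _ = ∑' q : ↥(Zd.sawWalksAt 2 n w), ENNReal.ofReal (x ^ n) :=
        ((fiberEquiv n w).symm.tsum_eq (fun _ => ENNReal.ofReal (x ^ n)))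
          |>.symm
    _ = (Zd.countAt 2 n w : ℝ≥0∞) * ENNReal.ofReal (x ^ n) := by
        rw [tsum_fintype, Finset.sum_const, Finset.card_univ, Fintype.card_coe, Zd.card_sawWalksAt,
          nsmul_eq_mul]

/-- Below `x_c` the susceptibility series is finite in `[0,∞]`: `Σ_n c_n x^n < ∞` for
`0 < x < x_c` (geometric domination, from the tree's `Zd.exists_bound_count_mul_pow` at the
midpoint `(x + x_c)/2`). [cite: BDGS2012, §1.5.3] -/
theorem tsum_count_mul_pow_ne_top {x : ℝ} (hx0 : 0 < x) (hx : x < criticalFugacity) :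
    ∑' n : ℕ, (Zd.count 2 n : ℝ≥0∞) * ENNReal.ofReal (x ^ n) ≠ ⊤ := by
  set z : ℝ := (x + criticalFugacity) / 2 with hz
  have hz0 : 0 < z := by rw [hz]; linarith
  have hxz : x < z := by rw [hz]; linarith
  have hzc : z < Zd.criticalPoint 2 := by rw [Zd.criticalPoint_two, hz]; linarith
  obtain ⟨K, hK⟩ := Zd.exists_bound_count_mul_pow hz0 hzc
  have hK0 : 0 ≤ K := le_trans (by positivity) (hK 0)
  set r : ℝ := x / z with hr
  have hr0 : 0 ≤ r := div_nonneg hx0.le hz0.le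
  have hr1 : r < 1 := (div_lt_one hz0).2 hxz
  have hterm : ∀ n, (Zd.count 2 n : ℝ≥0∞) * ENNReal.ofReal (x ^ n) ≤
      ENNReal.ofReal K * ENNReal.ofReal r ^ n := by
    intro n
    have h1 : (Zd.count 2 n : ℝ) * x ^ n ≤ K * r ^ n := by
      have hxn : x ^ n = z ^ n * r ^ n := by
        rw [← mul_pow]; congr 1; rw [hr]; field_simp
      rw [hxn, ← mul_assoc]
      exact mul_le_mul_of_nonneg_right (hK n) (pow_nonneg hr0 n)
    calc (Zd.count 2 n : ℝ≥0∞) * ENNReal.ofReal (x ^ n)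
        = ENNReal.ofReal ((Zd.count 2 n : ℝ) * x ^ n) := by
          rw [ENNReal.ofReal_mul (Nat.cast_nonneg _), ENNReal.ofReal_natCast]
      _ ≤ ENNReal.ofReal (K * r ^ n) := ENNReal.ofReal_le_ofReal h1
      _ = ENNReal.ofReal K * ENNReal.ofReal r ^ n := by
          rw [ENNReal.ofReal_mul hK0, ENNReal.ofReal_pow hr0]
  refine ne_top_of_le_ne_top ?_ (ENNReal.tsum_le_tsum hterm)
  rw [ENNReal.tsum_mul_left, ENNReal.tsum_geometric]
  refine ENNReal.mul_ne_top ENNReal.ofReal_ne_top (ENNReal.inv_ne_top.2 ?_)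
  exact (tsub_pos_iff_lt.2 ((ENNReal.ofReal_lt_one).2 hr1)).ne'

/-- Uniform subcritical bound on the WHOLE lattice two-point function:
`K_x(u,v) ≤ Σ_n c_n x^n < ∞` for `0 < x < x_c`, all `u, v`. [cite: BDGS2012, §1.5.3] -/
theorem latticeKernel_le_tsum_count (x : ℝ) (u v : Site 2) :
    latticeKernel x u v ≤ ∑' n : ℕ, (Zd.count 2 n : ℝ≥0∞) * ENNReal.ofReal (x ^ n) := by
  rw [latticeKernel_eq_zero_sub, latticeKernel_zero_eq_tsum_countAt]
  refine ENNReal.tsum_le_tsum fun n => mul_le_mul_of_nonneg_right ?_ zero_le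
  exact_mod_cast Zd.countAt_le_count n (v - u)

/-- **THE SUBCRITICAL SIDE IS TRUE, even without `u ∼ v`**: for `0 < x < x_c` the fugacity-`x`
two-point partition functions of all domains between ALL pairs of sites are bounded by the
finite susceptibility `χ(x) = Σ_n c_n x^n`. Hence the crux sits exactly at the edge: TRUE in
the strongest form for `x < x_c` (this theorem), FALSE for `x > x_c` (§4); at `x = x_c` the
susceptibility bound is useless (`χ(x_c) = ∞`, §6) and only the ADJACENCY of `u, v` (closing
into polygons, an extra factor `n^{-(α_sing - ...)}`) can save finiteness. [cite: BDGS2012, §1.5.3] -/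
theorem criticalBubbleBoundAt_of_lt_criticalFugacity {x : ℝ} (hx0 : 0 < x) (hx : x < criticalFugacity) :
    ∃ C : ℝ≥0∞, C ≠ ⊤ ∧ ∀ (Ω : Set ℂ) (δ : ℝ) (u v : Site 2), weightAt x Ω δ u v univ ≤ C :=
  ⟨_, tsum_count_mul_pow_ne_top hx0 hx, fun Ω δ u v =>
    (weightAt_univ_le_latticeKernel x Ω δ u v).trans (latticeKernel_le_tsum_count x u v)⟩

/-- In particular `CriticalBubbleBoundAt x` holds for `0 < x < x_c`. [cite: BDGS2012, §1.5.3] -/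
theorem criticalBubbleBoundAt_of_lt {x : ℝ} (hx0 : 0 < x) (hx : x < criticalFugacity) :
    CriticalBubbleBoundAt x := by
  obtain ⟨C, hC, h⟩ := criticalBubbleBoundAt_of_lt_criticalFugacity hx0 hx
  exact ⟨C, hC, fun Ω δ u v _ _ _ => h Ω δ u v⟩

/-! ## §11 Approach to criticality: the crux ⟺ no blow-up of the subcritical nearest-neighbour
two-point function as `x ↑ x_c` (left-continuity of a power series with nonnegative coefficients) -/

/-- Monotonicity of the kernel in the fugacity (on `x ≥ 0`). [folklore] -/
theorem latticeKernel_mono {x y : ℝ} (hx : 0 ≤ x) (hxy : x ≤ y) (u v : Site 2) :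
    latticeKernel x u v ≤ latticeKernel y u v :=
  ENNReal.tsum_le_tsum fun _ => ENNReal.ofReal_le_ofReal (pow_le_pow_left₀ hx hxy _)

/-- **Left-continuity at `x_c`**: `K_{x_c}(u,v) = sup_{0 ≤ x < x_c} K_x(u,v)` (monotone convergence
for a power series with nonnegative coefficients, valid whether or not the value is finite). [folklore] -/
theorem latticeKernel_criticalFugacity_eq_iSup (u v : Site 2) :
    latticeKernel criticalFugacity u v =
      ⨆ x : Set.Ico (0 : ℝ) criticalFugacity, latticeKernel x.1 u v := by
  have hxc := criticalFugacity_pos_lt_one'.1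
  refine le_antisymm ?_ (iSup_le fun x => latticeKernel_mono x.2.1 x.2.2.le u v)
  rw [latticeKernel, ENNReal.tsum_eq_iSup_sum]
  refine iSup_le fun s => ?_
  -- the finite sum is continuous in the fugacity, hence its value at `x_c` is a limit from the left
  set g : ℝ → ℝ≥0∞ := fun x => ∑ p ∈ s, ENNReal.ofReal (x ^ p.1.length) with hg
  have hcont : Continuous g := by
    refine continuous_finsetSum _ fun p _ => ?_
    exact ENNReal.continuous_ofReal.comp (continuous_pow _)
  have htend : Tendsto g (𝓝[<] criticalFugacity) (𝓝 (g criticalFugacity)) :=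
    (hcont.tendsto _).mono_left nhdsWithin_le_nhds
  have hev : ∀ᶠ x in 𝓝[<] criticalFugacity,
      g x ≤ ⨆ x : Set.Ico (0 : ℝ) criticalFugacity, latticeKernel x.1 u v := by
    have hmem : Set.Ioo (0 : ℝ) criticalFugacity ∈ 𝓝[<] criticalFugacity :=
      Ioo_mem_nhdsLT hxc
    filter_upwards [hmem] with x hx
    calc g x ≤ latticeKernel x u v := by rw [hg, latticeKernel]; exact ENNReal.sum_le_tsum _
      _ ≤ ⨆ x : Set.Ico (0 : ℝ) criticalFugacity, latticeKernel x.1 u v :=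
          le_iSup (fun x : Set.Ico (0 : ℝ) criticalFugacity => latticeKernel x.1 u v) ⟨x, hx.1.le, hx.2⟩
  exact le_of_tendsto htend hev

/-- **THE CRUX AS A STATEMENT ABOUT THE APPROACH TO CRITICALITY.** `CriticalBubbleBound` holds iff
the (finite, §5) subcritical nearest-neighbour kernels stay bounded as `x ↑ x_c`:
`∃ C < ∞, ∀ x ∈ (0, x_c), ∀ u ∼ v, K_x(u,v) ≤ C`. In exponent language: the susceptibility
`χ(x) ↑ ∞` (γ = 43/32) while `G_x(0,e) = x + Σ (m/2) p_m x^{m-1}` should converge to a finite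
limit (`1 - α = 1/2 > 0`); the crux is precisely the absence of a divergence of the ENERGY-like
quantity `G_x(0,e)` at `x_c⁻`. [cite: MadrasSlade1993, §1.4] -/
theorem criticalBubbleBound_iff_subcritical_bounded :
    CriticalBubbleBound ↔ ∃ C : ℝ≥0∞, C ≠ ⊤ ∧ ∀ x : ℝ, 0 < x → x < criticalFugacity →
      ∀ u v : Site 2, (zdGraph 2).Adj u v → latticeKernel x u v ≤ C := by
  rw [criticalBubbleBound_iff_latticeKernel]
  constructor
  · rintro ⟨C, hC, h⟩
    exact ⟨C, hC, fun x hx0 hx u v huv => (latticeKernel_mono hx0.le hx.le u v).trans (h u v huv)⟩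
  · rintro ⟨C, hC, h⟩
    refine ⟨C, hC, fun u v huv => ?_⟩
    rw [latticeKernel_criticalFugacity_eq_iSup]
    refine iSup_le fun x => ?_
    rcases x.2.1.eq_or_lt with h0 | h0
    · -- `x = 0`: only the trivial walk could weigh, and `u ≠ v`
      calc latticeKernel x.1 u v ≤ latticeKernel (criticalFugacity / 2) u v :=
            latticeKernel_mono x.2.1 (by rw [← h0]; linarith [criticalFugacity_pos_lt_one'.1]) u v
        _ ≤ C := h _ (by linarith [criticalFugacity_pos_lt_one'.1])
            (by linarith [criticalFugacity_pos_lt_one'.1]) u v huv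
    · exact h x.1 h0 x.2.2 u v huv

end Summit.CriticalPhenomena.SAWScalingLimit.Theorems.CriticalBubbleBound.Negative
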